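import Summits.AtomisticToContinuum.HydrodynamicLimit.Theorems.BoxDissipativeWeakStrongFluxClosureKinStaticGeneral
import Summits.AtomisticToContinuum.HydrodynamicLimit.Theorems.BoxDissipativeWeakStrongFluxClosureKineticIsotropyTight
import Summits.AtomisticToContinuum.HydrodynamicLimit.Theorems.RelayRaceLocalityNearConstantShortTimeHLEntropyPrice
import Summits.AtomisticToContinuum.HydrodynamicLimit.Theorems.BoxDissipativeWeakStrongFluxClosureEqKineticIsotropy
import HarnessLib

/-!
# Crux `FluxClosure` (stmt-AtomisticToContinuum-9902, route BoxDissipativeWeakStrong), line `registered`: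
# kinetic isotropy along the flow from relative-entropy local equilibrium (sub-goal H2 of the entropy line for K)

Support file (`--supports stmt-AtomisticToContinuum-9902`) for the crux
`Summit.AtomisticToContinuum.HydrodynamicLimit.Theses.BoxDissipativeWeakStrong.FluxClosure`. The open stub K
(`stub_kineticIsotropy`) of the crux skeleton asserts that the traceless box peculiar velocity covariance of
`N + 1` deterministic hard spheres (cube kernel at a kinetic window `ℓ_N`), tested against `∇w` and integrated over
`(0, τ] × 𝕋³` ALONG THE FLOW, tends to `0` in `L¹(P_N)`, `P_N` the local Gibbs law of the initial profiles. This
file proves the ENTROPY LINE for K (registered sub-goal H2, `kineticIsotropy_of_relEntropy`): the conclusion of K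
holds for a flow family, window, horizon and test field AS SOON AS

* (H1, hypothesis) the static K-integrand `X_G(z) = ∫ₓ Σᵢⱼ Aᵢⱼ(z, x) Gᵢⱼ(x) dx` has speed-`(N+1)` exponential
  moments `∫ exp(γ (N+1) |X_G|) dQ ≤ exp((N+1)(C (γB)² + γB · C(δθ + δu²) + C ((N+1)ℓ³)⁻¹))` under every local
  Gibbs MEASURE `Q` whose profiles are `(δu, δθ)`-local on the kernel support (proved separately), and
* (entropy hypothesis) the law at time `t` of the system is `o(N)`-close in relative entropy to SOME local Gibbs
  measure with continuous parameter profiles `(a t, u t, θ t)`, uniformly on `[0, τ]`: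
  `H((Φ_t)_* P_N ‖ Q_{N,t}) ≤ (N+1) h_N`, `h_N → 0` (Yau's relative-entropy form of local equilibrium, with
  free parameters).

Proof (H.-T. Yau's entropy inequality, slice by slice in time). `ofReal |∫ₜ| ≤ ∫⁻ₜ ofReal |·|` and Tonelli on
`P_N ⊗ dt` (the flow is jointly measurable on `good × ℝ`, `FluxClosureEq.E7.E7_aemeasurable_comp_flow_prod`); at
each `t ∈ (0, τ]` the entropy inequality `E_P[G ∘ Φ_t] ≤ c⁻¹ (H((Φ_t)_* P ‖ Q) + log ∫ e^{cG} dQ)`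
(`NearConstantShortTimeHL.integral_comp_flow_le_klDiv_add_log_of_nonneg`, with `G = |X_{∂w(t,·)}|`, integrable
along the flow by the pathwise energy bound `FluxClosureK.abs_integral_kinIntegrand_le` and energy conservation)
with `c = γ (N+1)` and the exponential moment (H1) at the profiles `(a t, u t, θ t)` gives
`E_P |X(Φ_t z)| ≤ γ⁻¹ (h_N + C (γB)² + γB C(δ + δ²) + C((N+1)ℓ_N³)⁻¹)`; the locality errors `δ` are uniform in
`t ∈ [0, τ]` once `ℓ_N` is below a threshold, by uniform continuity of `(t, x) ↦ u t x, θ t x` on the compact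
`[0, τ] × 𝕋³` (`LGFS.dist_lt_of_boxK_ne_zero`). Integrating over `(0, τ]` and choosing `γ`, then `δ`, then `N`
large gives the limit `0`.

No definitions. References: H.-T. Yau, Lett. Math. Phys. 22 (1991) 63–80 (relative entropy method);
S. Olla, S. R. S. Varadhan, H.-T. Yau, Comm. Math. Phys. 155 (1993), §3; C. Kipnis, C. Landim, *Scaling Limits of
Interacting Particle Systems* (1999), Appendix 1 §8 (entropy inequality); H. Spohn, *Large Scale Dynamics of
Interacting Particles* (1991), Part I §3.3.
-/

noncomputable section

namespace Summit.AtomisticToContinuum.HydrodynamicLimit.Theorems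
namespace FluxClosureEnt

open scoped BigOperators Topology Classical MeasureTheory ProbabilityTheory InnerProductSpace ENNReal
open Filter Set Function MeasureTheory ProbabilityTheory
open Literature.MathematicalPhysics.KineticTheory Literature.Analysis.FluidPDE Literature.Analysis.FunctionSpaces
open Summit.AtomisticToContinuum.HydrodynamicLimit.Theses.BoxDissipativeWeakStrong

/-- **Entropy inequality for an energy-dominated static functional along the flow, `lintegral` form.** For a
hard-sphere flow `Ψ`, a probability law `P ≪ Liouville`, a reference probability law `Q` with
`H((Ψ_t)_* P ‖ Q) ≤ K₀`, a measurable `F` with `|F| ≤ A · n⁻¹Σ_a‖v_a‖²` (finite `P`-mean of the latter) and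
`∫ e^{c|F|} dQ ≤ e^κ`, `c > 0`: `∫⁻ |F(Ψ_t z)| dP ≤ c⁻¹ (K₀ + κ)` (`|F ∘ Ψ_t|` is `P`-integrable by energy
conservation on the good set; then `NearConstantShortTimeHL.integral_comp_flow_le_klDiv_add_log_of_nonneg`).
[cite: KipnisLandim1999, Appendix 1 §8] -/
theorem lintegral_abs_comp_flow_le_of_klDiv_le {ε : ℝ} {n : ℕ} (Ψ : HardSphereFlow (Torus.geometry (Fin 3)) ε n)
    (P Q : Measure (Config n (Fin 3) T3)) [IsProbabilityMeasure P] [IsProbabilityMeasure Q]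
    (hP : P ≪ liouville (Torus.geometry (Fin 3)) n ε) (t : ℝ) {K₀ : ℝ} (hK₀ : 0 ≤ K₀)
    (hKL : InformationTheory.klDiv (Ψ.lawAt P t) Q ≤ ENNReal.ofReal K₀)
    {F : Config n (Fin 3) T3 → ℝ} (hF : Measurable F) {A : ℝ}
    (hFA : ∀ c, |F c| ≤ A * ((n : ℝ)⁻¹ * ∑ a, ‖(c a).2‖ ^ 2))
    (hE : ∫⁻ z, ENNReal.ofReal ((n : ℝ)⁻¹ * ∑ a, ‖(z a).2‖ ^ 2) ∂P ≠ ⊤) {c κ : ℝ} (hc : 0 < c)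
    (hexp : ∫⁻ w, ENNReal.ofReal (Real.exp (c * |F w|)) ∂Q ≤ ENNReal.ofReal (Real.exp κ)) :
    ∫⁻ z, ENNReal.ofReal |F (Ψ.flow t z)| ∂P ≤ ENNReal.ofReal (c⁻¹ * (K₀ + κ)) := by
  -- the dominator `A · n⁻¹Σ_a‖v_a‖²` is `P`-integrable
  have hmeasE : Measurable fun z : Config n (Fin 3) T3 => (n : ℝ)⁻¹ * ∑ a, ‖(z a).2‖ ^ 2 :=
    measurable_const.mul (Finset.measurable_sum _ fun a _ => ((measurable_pi_apply a).snd.norm.pow_const 2))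
  have hintE : Integrable (fun z : Config n (Fin 3) T3 => A * ((n : ℝ)⁻¹ * ∑ a, ‖(z a).2‖ ^ 2)) P := by
    refine Integrable.const_mul ⟨hmeasE.aestronglyMeasurable, ?_⟩ A
    exact (hasFiniteIntegral_iff_ofReal (ae_of_all _ fun z => by positivity)).2 (lt_top_iff_ne_top.2 hE)
  -- hence so is `|F ∘ Ψ_t|` (energy conservation on the good set, conull for `P`)
  have hFm : Measurable fun w => |F w| := continuous_abs.measurable.comp hF
  have hint : Integrable (fun z => |F (Ψ.flow t z)|) P := by
    refine hintE.mono' (hFm.comp (Ψ.measurable_flow t)).aestronglyMeasurable ?_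
    filter_upwards [NearConstantShortTimeHL.sum_norm_sq_vel_flow_ae Ψ hP t] with z hz
    rw [Real.norm_eq_abs, abs_abs]
    calc |F (Ψ.flow t z)| ≤ A * ((n : ℝ)⁻¹ * ∑ a, ‖(Ψ.flow t z a).2‖ ^ 2) := hFA _
      _ = A * ((n : ℝ)⁻¹ * ∑ a, ‖(z a).2‖ ^ 2) := by rw [hz]
  have h := NearConstantShortTimeHL.integral_comp_flow_le_klDiv_add_log_of_nonneg Ψ P Q t
    (ne_top_of_le_ne_top ENNReal.ofReal_ne_top hKL) hFm (fun w => abs_nonneg _) hint hc hexp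
  rw [← ofReal_integral_eq_lintegral_ofReal hint (ae_of_all _ fun z => abs_nonneg _)]
  refine ENNReal.ofReal_le_ofReal (h.trans ?_)
  have hKr : (InformationTheory.klDiv (Ψ.lawAt P t) Q).toReal ≤ K₀ := ENNReal.toReal_le_of_le_ofReal hK₀ hKL
  exact mul_le_mul_of_nonneg_left (add_le_add hKr le_rfl) (inv_nonneg.2 hc.le)

/-- **Sub-goal H2 of crux `FluxClosure` (entropy line for stub K).** GIVEN the speed-`(N+1)` exponential-moment
property (H1) of the static K-integrand under local Gibbs measures with `(δu, δθ)`-local profiles (first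
hypothesis, verbatim the statement of sub-goal H1): for `0 < σ ≤ 1/2`, continuous initial profiles
`a₀, θ₀ > 0`, `u₀`, every flow family `Φ`, every kinetic window (`0 < ℓ_N ≤ 1`, `ℓ_N → 0`, `(N+1)ℓ_N³ → ∞`),
`τ ∈ [0, T)`, `w` smooth on `[0, T) × 𝕋³`, and reference parameter profiles `a, θ > 0`, `u` jointly continuous on
`ℝ × 𝕋³`, IF the law of the system at time `t` is within relative entropy `(N+1) h_N`, `h_N → 0`, of the local
Gibbs measure of `(a t, u t, θ t)` uniformly in `t ∈ [0, τ]`, THEN the kinetic deviation functional of the crux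
tends to `0` in `L¹(P_N)` (verbatim the conclusion of `stub_kineticIsotropy`). Proof: module docstring.
[cite: OllaVaradhanYau1993, §3] -/
theorem kineticIsotropy_of_relEntropy : (∀ θM : ℝ, 0 < θM → ∃ C : ℝ, 0 ≤ C ∧ ∃ γ₀ : ℝ, 0 < γ₀ ∧ ∀ (σ : ℝ) (a₀ θ₀ : T3 → ℝ) (u₀ : T3 → V3), σ ≤ 1 / 2 → Continuous a₀ → Continuous θ₀ → Continuous u₀ → (∀ x, 0 < a₀ x) → (∀ x, 0 < θ₀ x) → (∀ x, θ₀ x ≤ θM) → ∀ (N : ℕ) (l δu δθ : ℝ), 0 < l → l ≤ 1 → 0 ≤ δu → δu ≤ 1 → 0 ≤ δθ → (∀ x y : T3, indicator {y' : T3 | ∀ i, ‖y' i - x i‖ < l / 2} (fun _ => (l ^ 3)⁻¹) y ≠ 0 → ‖u₀ y - u₀ x‖ ≤ δu ∧ |θ₀ y - θ₀ x| ≤ δθ) → ∀ (G : T3 → Fin 3 → Fin 3 → ℝ) (B : ℝ), (∀ i j, Measurable fun x => G x i j) → (∀ x i j, |G x i j| ≤ B) → ∀ γ : ℝ, 0 <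 γ → γ * B ≤ γ₀ → let K := fun (x y : T3) => indicator {y' : T3 | ∀ i, ‖y' i - x i‖ < l / 2} (fun _ => (l ^ 3)⁻¹) y; let Dn := fun (z : Config (N + 1) (Fin 3) T3) (x : T3) => empiricalDensityField z (K x); let Mm := fun (z : Config (N + 1) (Fin 3) T3) (x : T3) => empiricalMomentumField z (K x); let En := fun (z : Config (N + 1) (Fin 3) T3) (x : T3) => empiricalEnergyField z (K x); let Sk := fun (z : Config (N + 1) (Fin 3) T3) (x : T3) (i j : Fin 3) => ∫ y, K x y.1 * (y.2 i * y.2 j) ∂(empiricalMeasure z); let Th := fun (r : ℝ) (m : V3) (E : ℝ) => 2 / 3 * (E / r - ‖m‖ ^ 2 / (2 * r ^ 2)); ∫⁻ z, ENNReal.ofReal (Real.exp (γ * ((N : ℝ) + 1) * |∫ x, ∑ i, ∑ j, (Sk z x i j - Mm z x i * Mm z x j / Dn z x - (if i = j then Dn z x * Th (Dn z x) (Mm z x) (En z x) else 0)) * G x i j|)) ∂(localGibbsMeasure σ a₀ u₀ θ₀ N) ≤ ENNReal.ofReal (Real.exp (((N : ℝ) + 1) * (C * (γ * B) ^ 2 +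 γ * B * (C * (δθ + δu ^ 2)) + C * (((N : ℝ) + 1) * l ^ 3)⁻¹)))) → ∀ (σ : ℝ) (a₀ θ₀ : T3 → ℝ) (u₀ : T3 → V3), 0 < σ → σ ≤ 1 / 2 → Continuous a₀ → Continuous θ₀ → Continuous u₀ → (∀ x, 0 < a₀ x) → (∀ x, 0 < θ₀ x) → ∀ (Φ : (N : ℕ) → HardSphereFlow (Torus.geometry (Fin 3)) (hsDiameter σ N) (N + 1)) (ℓ : ℕ → ℝ), (∀ N, 0 < ℓ N ∧ ℓ N ≤ 1) → Tendsto ℓ atTop (𝓝 0) → Tendsto (fun N : ℕ => ℓ N ^ 3 * ((N : ℝ) + 1)) atTop atTop → ∀ (T τ : ℝ), τ ∈ Ico 0 T → ∀ (w : ℝ → T3 → V3), Torus.IsSmoothSpaceTimeOn (Ico 0 T) w → ∀ (a θ : ℝ → T3 → ℝ) (u : ℝ → T3 → V3), Continuous (fun p : ℝ × T3 => a p.1 p.2) → Continuous (fun p : ℝ × T3 => θ p.1 p.2) → Continuous (fun p : ℝ × T3 => u p.1 p.2) → (∀ t x, 0 < a t x) → (∀ t x, 0 < θ t x) → (∃ h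 : ℕ → ℝ, Tendsto h atTop (𝓝 0) ∧ ∀ (N : ℕ) (t : ℝ), t ∈ Icc 0 τ → InformationTheory.klDiv ((Φ N).lawAt (localGibbsLaw σ a₀ u₀ θ₀ N (Φ N)) t) (localGibbsMeasure σ (a t) (u t) (θ t) N) ≤ ENNReal.ofReal (((N : ℝ) + 1) * h N)) → let K := fun (l : ℝ) (x y : T3) => indicator {y' : T3 | ∀ i, ‖y' i - x i‖ < l / 2} (fun _ => (l ^ 3)⁻¹) y; let Dn := fun N t z x => empiricalDensityField ((Φ N).flow t z) (K (ℓ N) x); let Mm := fun N t z x => empiricalMomentumField ((Φ N).flow t z) (K (ℓ N) x); let En := fun N t z x => empiricalEnergyField ((Φ N).flow t z) (K (ℓ N) x); let Sk := fun N t z x (i j : Fin 3) => ∫ y, K (ℓ N) x y.1 * (y.2 i * y.2 j) ∂(empiricalMeasure ((Φ N).flow t z)); let Th := fun (r : ℝ) (m : V3) (E : ℝ) => 2 / 3 * (E / r - ‖m‖ ^ 2 / (2 * r ^ 2)); Tendsto (fun N : ℕ => ∫⁻ z, ENNReal.ofReal (|∫ t in Ioc 0 τ, ∫ x, ∑ i,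 ∑ j, (Sk N t z x i j - Mm N t z x i * Mm N t z x j / Dn N t z x - (if i = j then Dn N t z x * Th (Dn N t z x) (Mm N t z x) (En N t z x) else 0)) * Torus.partialDeriv j (fun y => w t y i) x|) ∂(localGibbsLaw σ a₀ u₀ θ₀ N (Φ N))) atTop (𝓝 0) := by
  intro H1 σ a₀ θ₀ u₀ _hσ0 hσ ha hθ hu ha0 hθ0 Φ ℓ hℓ hℓ0 hℓ3 T τ hτ w hw a θ u hac hθc huc hapos hθpos hent
  dsimp only
  obtain ⟨h, hh0, hKL⟩ := hent
  /- `N`-independent data: a bound on `∇w` over `[0, τ] × 𝕋³`, a clamp of the time axis into the slab, the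
  clamped (jointly measurable) test factor `G'`, a temperature bound on `[0, τ] × 𝕋³` and the constants of (H1) -/
  obtain ⟨Cw, hCw0, hCw⟩ := FluxClosureK.exists_forall_abs_partialDeriv_le_slab hτ.2 hw
  obtain ⟨ρc, hρc, hρS, hρeq⟩ := FluxClosureB5.exists_clamp hτ
  obtain ⟨G', hG'⟩ : ∃ G' : ℝ × T3 → Fin 3 → Fin 3 → ℝ, ∀ q i j, G' q i j =
      Torus.partialDeriv j (fun y => w (ρc q.1) y i) q.2 := ⟨_, fun _ _ _ => rfl⟩
  have hG'm : ∀ i j, Measurable fun q : ℝ × T3 => G' q i j := fun i j => by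
    simp only [hG']
    exact FluxClosureB5.measurable_partialDeriv_comp_clamp hw (uniqueDiffOn_Ico 0 T) hρc hρS i j
  have hG'eq : ∀ t ∈ Ioc 0 τ, ∀ x i j, G' (t, x) i j = Torus.partialDeriv j (fun y => w t y i) x :=
    fun t ht x i j => by rw [hG', hρeq t ht]
  have hG'b : ∀ t ∈ Ioc 0 τ, ∀ x i j, |G' (t, x) i j| ≤ Cw := fun t ht x i j => by
    rw [hG'eq t ht]
    exact hCw t ⟨ht.1.le, ht.2⟩ i j x
  obtain ⟨θM', hθM'⟩ := (isCompact_Icc.prod isCompact_univ).bddAbove_image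
    (f := fun p : ℝ × T3 => θ p.1 p.2) (K := Icc 0 τ ×ˢ univ) hθc.continuousOn
  have hθM : ∀ t ∈ Icc 0 τ, ∀ x, θ t x ≤ max θM' 1 := fun t ht x =>
    (hθM' ⟨(t, x), mk_mem_prod ht (mem_univ x), rfl⟩).trans (le_max_left _ _)
  obtain ⟨C, hC0, γ₀, hγ₀, hC1⟩ := H1 (max θM' 1) (lt_max_of_lt_right one_pos)
  clear H1
  -- second moments of the initial velocities, and the two vanishing rates
  obtain ⟨B₁, hB₁⟩ := isCompact_univ.bddAbove_image (f := fun x : T3 => 3 * θ₀ x + ‖u₀ x‖ ^ 2) (K := univ)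
    (by fun_prop : Continuous fun x : T3 => 3 * θ₀ x + ‖u₀ x‖ ^ 2).continuousOn
  have hB₁' : ∀ x, 3 * θ₀ x + ‖u₀ x‖ ^ 2 ≤ B₁ := fun x => hB₁ ⟨x, mem_univ x, rfl⟩
  have hr : Tendsto (fun N : ℕ => (((N : ℝ) + 1) * ℓ N ^ 3)⁻¹) atTop (𝓝 0) :=
    hℓ3.inv_tendsto_atTop.congr fun N => by rw [Pi.inv_apply, mul_comm]
  have hha : Tendsto (fun N => |h N|) atTop (𝓝 0) := by simpa using hh0.abs
  /- the `ε`-argument: target `η'`, tilt `γ`, locality error `δ`, window threshold by uniform continuity -/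
  rw [ENNReal.tendsto_nhds_zero]
  intro ηe hηe
  obtain ⟨η', hη', hle⟩ : ∃ η' : ℝ, 0 < η' ∧ ENNReal.ofReal η' ≤ ηe := by
    rcases eq_or_ne ηe ⊤ with he | he
    · exact ⟨1, one_pos, he ▸ le_top⟩
    · exact ⟨ηe.toReal, ENNReal.toReal_pos hηe.ne' he, ENNReal.ofReal_toReal_le⟩
  have hτ0 : 0 ≤ τ := hτ.1
  have hη4 : 0 < η' / 4 := by positivity
  obtain ⟨γ, hγ0, hγB, hγs⟩ : ∃ γ : ℝ, 0 < γ ∧ γ * Cw ≤ γ₀ ∧ τ * (γ * (C * Cw ^ 2)) ≤ η' / 4 := by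
    have h1 : Tendsto (fun γ : ℝ => γ * Cw) (𝓝[>] 0) (𝓝 0) := tendsto_nhdsWithin_of_tendsto_nhds
      ((by fun_prop : Continuous fun γ : ℝ => γ * Cw).tendsto' 0 0 (by simp))
    have h2 : Tendsto (fun γ : ℝ => τ * (γ * (C * Cw ^ 2))) (𝓝[>] 0) (𝓝 0) := tendsto_nhdsWithin_of_tendsto_nhds
      ((by fun_prop : Continuous fun γ : ℝ => τ * (γ * (C * Cw ^ 2))).tendsto' 0 0 (by simp))
    obtain ⟨γ, ⟨h1', h2'⟩, hγ0⟩ :=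
      (((h1.eventually_le_const hγ₀).and (h2.eventually_le_const hη4)).and self_mem_nhdsWithin).exists
    exact ⟨γ, hγ0, h1', h2'⟩
  obtain ⟨δ, hδ0, hδ1, hδs⟩ : ∃ δ : ℝ, 0 < δ ∧ δ ≤ 1 ∧ τ * (Cw * (C * (δ + δ ^ 2))) ≤ η' / 4 := by
    have h2 : Tendsto (fun δ : ℝ => τ * (Cw * (C * (δ + δ ^ 2)))) (𝓝[>] 0) (𝓝 0) :=
      tendsto_nhdsWithin_of_tendsto_nhds
        ((by fun_prop : Continuous fun δ : ℝ => τ * (Cw * (C * (δ + δ ^ 2)))).tendsto' 0 0 (by simp))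
    obtain ⟨δ, ⟨h1', h2'⟩, hδ0⟩ := ((((eventually_le_nhds one_pos).filter_mono nhdsWithin_le_nhds).and
      (h2.eventually_le_const hη4)).and self_mem_nhdsWithin).exists
    exact ⟨δ, hδ0, h1', h2'⟩
  have hcpt : IsCompact (Icc 0 τ ×ˢ (univ : Set T3)) := isCompact_Icc.prod isCompact_univ
  obtain ⟨ρu, hρu0, hρu⟩ := Metric.uniformContinuousOn_iff_le.1
    (hcpt.uniformContinuousOn_of_continuous huc.continuousOn) δ hδ0
  obtain ⟨ρθ, hρθ0, hρθ⟩ := Metric.uniformContinuousOn_iff_le.1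
    (hcpt.uniformContinuousOn_of_continuous hθc.continuousOn) δ hδ0
  -- locality of the cube kernel below the threshold, for EVERY profile `u t, θ t`, `t ∈ [0, τ]`
  have hloc : ∀ N, ℓ N < min ρu ρθ → ∀ t ∈ Icc 0 τ, ∀ x y : T3,
      Set.indicator {y' : T3 | ∀ i, ‖y' i - x i‖ < ℓ N / 2} (fun _ => (ℓ N ^ 3)⁻¹) y ≠ 0 →
      ‖u t y - u t x‖ ≤ δ ∧ |θ t y - θ t x| ≤ δ := by
    intro N hN t ht x y hK
    have hd : dist ((t, y) : ℝ × T3) (t, x) ≤ min ρu ρθ := by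
      rw [Prod.dist_eq, dist_self, max_eq_right dist_nonneg]
      linarith [LGFS.dist_lt_of_boxK_ne_zero (hℓ N).1 hK, (hℓ N).1]
    have hy : ((t, y) : ℝ × T3) ∈ Icc 0 τ ×ˢ (univ : Set T3) := mk_mem_prod ht (mem_univ _)
    have hx : ((t, x) : ℝ × T3) ∈ Icc 0 τ ×ˢ (univ : Set T3) := mk_mem_prod ht (mem_univ _)
    constructor
    · simpa only [dist_eq_norm] using hρu _ hy _ hx (hd.trans (min_le_left _ _))
    · simpa only [Real.dist_eq] using hρθ _ hy _ hx (hd.trans (min_le_right _ _))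
  -- the real bound at level `N`, its limit, and the eventual regime
  have hβ : Tendsto (fun N : ℕ => τ * (γ⁻¹ * (|h N| + C * (γ * Cw) ^ 2 + γ * Cw * (C * (δ + δ ^ 2)) +
      C * (((N : ℝ) + 1) * ℓ N ^ 3)⁻¹))) atTop
      (𝓝 (τ * (γ⁻¹ * (0 + C * (γ * Cw) ^ 2 + γ * Cw * (C * (δ + δ ^ 2)) + C * 0)))) :=
    ((((hha.add tendsto_const_nhds).add tendsto_const_nhds).add (hr.const_mul C)).const_mul γ⁻¹).const_mul τ
  have hγne : γ ≠ 0 := hγ0.ne'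
  have hL : τ * (γ⁻¹ * (0 + C * (γ * Cw) ^ 2 + γ * Cw * (C * (δ + δ ^ 2)) + C * 0)) < η' := by
    have e : τ * (γ⁻¹ * (0 + C * (γ * Cw) ^ 2 + γ * Cw * (C * (δ + δ ^ 2)) + C * 0)) =
        τ * (γ * (C * Cw ^ 2)) + τ * (Cw * (C * (δ + δ ^ 2))) := by
      field_simp
      ring
    rw [e]
    linarith
  filter_upwards [hβ.eventually_lt_const hL, hℓ0.eventually_lt_const (lt_min hρu0 hρθ0)] with N hβN hℓN
  /- FIX `N`. Abstract the integrand `S (c, x) i j` and the static functional `Hr (s, c) = ∫ₓ Σ S G'`. -/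
  obtain ⟨S, hS⟩ : ∃ S : Config (N + 1) (Fin 3) T3 × T3 → Fin 3 → Fin 3 → ℝ, ∀ p i j, S p i j =
      (∫ y, {y' : T3 | ∀ i, ‖y' i - p.2 i‖ < ℓ N / 2}.indicator (fun _ => (ℓ N ^ 3)⁻¹) y.1 * (y.2 i * y.2 j) ∂(empiricalMeasure p.1)) -
        empiricalMomentumField p.1 ({y' : T3 | ∀ i, ‖y' i - p.2 i‖ < ℓ N / 2}.indicator (fun _ => (ℓ N ^ 3)⁻¹)) i *
          empiricalMomentumField p.1 ({y' : T3 | ∀ i, ‖y' i - p.2 i‖ < ℓ N / 2}.indicator (fun _ => (ℓ N ^ 3)⁻¹)) j /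
          empiricalDensityField p.1 ({y' : T3 | ∀ i, ‖y' i - p.2 i‖ < ℓ N / 2}.indicator (fun _ => (ℓ N ^ 3)⁻¹)) -
        (if i = j then empiricalDensityField p.1 ({y' : T3 | ∀ i, ‖y' i - p.2 i‖ < ℓ N / 2}.indicator (fun _ => (ℓ N ^ 3)⁻¹)) *
          (2 / 3 * (empiricalEnergyField p.1 ({y' : T3 | ∀ i, ‖y' i - p.2 i‖ < ℓ N / 2}.indicator (fun _ => (ℓ N ^ 3)⁻¹)) /
              empiricalDensityField p.1 ({y' : T3 | ∀ i, ‖y' i - p.2 i‖ < ℓ N / 2}.indicator (fun _ => (ℓ N ^ 3)⁻¹)) -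
            ‖empiricalMomentumField p.1 ({y' : T3 | ∀ i, ‖y' i - p.2 i‖ < ℓ N / 2}.indicator (fun _ => (ℓ N ^ 3)⁻¹))‖ ^ 2 /
              (2 * empiricalDensityField p.1 ({y' : T3 | ∀ i, ‖y' i - p.2 i‖ < ℓ N / 2}.indicator (fun _ => (ℓ N ^ 3)⁻¹)) ^ 2)))
        else 0) := ⟨_, fun _ _ _ => rfl⟩
  have hSm : ∀ i j, Measurable fun p : Config (N + 1) (Fin 3) T3 × T3 => S p i j := fun i j => by
    simp only [hS]
    exact FluxClosureB5.measurable_kinDevIntegrand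
      (K := fun x y => {y' : T3 | ∀ i, ‖y' i - x i‖ < ℓ N / 2}.indicator (fun _ => (ℓ N ^ 3)⁻¹) y)
      (LGFS.measurable_boxK_uncurry (ℓ N)) i j
  obtain ⟨Hr, hHr⟩ : ∃ Hr : ℝ × Config (N + 1) (Fin 3) T3 → ℝ, ∀ p, Hr p =
      ∫ x, ∑ i, ∑ j, S (p.2, x) i j * G' (p.1, x) i j := ⟨_, fun _ => rfl⟩
  have hHrm : Measurable Hr := by
    have hF : Measurable fun q : (ℝ × Config (N + 1) (Fin 3) T3) × T3 =>
        ∑ i, ∑ j, S (q.1.2, q.2) i j * G' (q.1.1, q.2) i j := by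
      refine Finset.measurable_sum _ fun i _ => Finset.measurable_sum _ fun j _ => ?_
      exact ((hSm i j).comp (measurable_fst.snd.prodMk measurable_snd)).mul
        ((hG'm i j).comp (measurable_fst.fst.prodMk measurable_snd))
    rw [show Hr = fun p => ∫ x, ∑ i, ∑ j, S (p.2, x) i j * G' (p.1, x) i j from funext hHr]
    exact hF.stronglyMeasurable.integral_prod_right'.measurable
  have hHm : Measurable fun p => ENNReal.ofReal |Hr p| := (continuous_abs.measurable.comp hHrm).ennreal_ofReal
  -- the law: probability, absolutely continuous (carried by the good set), finite mean kinetic energy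
  set P : Measure (Config (N + 1) (Fin 3) T3) := localGibbsLaw σ a₀ u₀ θ₀ N (Φ N) with hP
  haveI hPpr : IsProbabilityMeasure P := isProbabilityMeasure_localGibbsLaw ha hθ hu ha0 hθ0 hσ N (Φ N)
  have hPac : P ≪ liouville (Torus.geometry (Fin 3)) (N + 1) (hsDiameter σ N) :=
    NearConstantShortTimeHL.particleLaw_absolutelyContinuous (Φ N) _
  have hPgood : P (Φ N).goodᶜ = 0 := hPac (Φ N).measure_compl_good
  have hE : ∫⁻ z, ENNReal.ofReal ((((N + 1 : ℕ)) : ℝ)⁻¹ * ∑ a, ‖(z a).2‖ ^ 2) ∂P ≤ ENNReal.ofReal B₁ := by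
    haveI : IsProbabilityMeasure (particleLaw (Φ N) (canonicalDensity (Torus.geometry (Fin 3)) (hsDiameter σ N)
      (N + 1) (localGibbsProfile a₀ u₀ θ₀))) := hPpr
    exact NearConstantShortTimeHL.lintegral_avg_norm_sq_vel_le (Φ N) ha hθ hu (fun x => (ha0 x).le) hθ0 hB₁'
  set bR : ℝ := γ⁻¹ * (|h N| + C * (γ * Cw) ^ 2 + γ * Cw * (C * (δ + δ ^ 2)) + C * (((N : ℝ) + 1) * ℓ N ^ 3)⁻¹)
    with hbR
  -- (A) pointwise in `z`: `ofReal |∫ₜ ∫ₓ| ≤ ∫⁻ₜ ofReal |Hr (t, Φ_t z)|` (unclamp on `(0, τ]`; junk-safe)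
  have hA : ∀ z, ENNReal.ofReal |∫ t in Ioc 0 τ, ∫ x, ∑ i, ∑ j, S ((Φ N).flow t z, x) i j *
      Torus.partialDeriv j (fun y => w t y i) x| ≤ ∫⁻ t in Ioc 0 τ, ENNReal.ofReal |Hr (t, (Φ N).flow t z)| := by
    intro z
    have heq : (∫ t in Ioc 0 τ, ∫ x, ∑ i, ∑ j, S ((Φ N).flow t z, x) i j * Torus.partialDeriv j (fun y => w t y i) x) =
        ∫ t in Ioc 0 τ, Hr (t, (Φ N).flow t z) := by
      refine setIntegral_congr_fun measurableSet_Ioc fun t ht => ?_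
      simp only [hHr, hG'eq t ht]
    rw [heq]
    exact FluxClosureEq.E7.E7_ofReal_abs_integral_le _ _
  -- (B) Tonelli on `P ⊗ dt|_(0,τ]`
  have hB : ∫⁻ z, (∫⁻ t in Ioc 0 τ, ENNReal.ofReal |Hr (t, (Φ N).flow t z)|) ∂P =
      ∫⁻ t in Ioc 0 τ, (∫⁻ z, ENNReal.ofReal |Hr (t, (Φ N).flow t z)| ∂P) :=
    lintegral_lintegral_swap
      (FluxClosureEq.E7.E7_aemeasurable_comp_flow_prod (Φ N) hHm hPgood (volume.restrict (Ioc 0 τ)))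
  -- (C) at each time `t ∈ (0, τ]`: the entropy inequality, fed with (H1) at the profiles `(a t, u t, θ t)`
  have hC : ∀ t ∈ Ioc 0 τ, ∫⁻ z, ENNReal.ofReal |Hr (t, (Φ N).flow t z)| ∂P ≤ ENNReal.ofReal bR := by
    intro t ht
    have htc : t ∈ Icc 0 τ := ⟨ht.1.le, ht.2⟩
    have hat : Continuous (a t) := hac.uncurry_left t
    have hθt : Continuous (θ t) := hθc.uncurry_left t
    have hut : Continuous (u t) := huc.uncurry_left t
    haveI : IsProbabilityMeasure (localGibbsMeasure σ (a t) (u t) (θ t) N) :=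
      isProbabilityMeasure_localGibbsMeasure hat hθt hut (fun x => hapos t x) (fun x => hθpos t x) hσ N
    -- the exponential moment (H1): window `ℓ N`, errors `(δ, δ)`, field `∂w(t, ·)`, bound `Cw`, tilt `γ`
    have hexp : ∫⁻ c, ENNReal.ofReal (Real.exp (γ * ((N : ℝ) + 1) * |Hr (t, c)|))
        ∂(localGibbsMeasure σ (a t) (u t) (θ t) N) ≤ ENNReal.ofReal (Real.exp (((N : ℝ) + 1) *
          (C * (γ * Cw) ^ 2 + γ * Cw * (C * (δ + δ ^ 2)) + C * (((N : ℝ) + 1) * ℓ N ^ 3)⁻¹))) := by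
      have key := hC1 σ (a t) (θ t) (u t) hσ hat hθt hut (fun x => hapos t x) (fun x => hθpos t x)
        (fun x => hθM t htc x) N (ℓ N) δ δ (hℓ N).1 (hℓ N).2 hδ0.le hδ1 hδ0.le (hloc N hℓN t htc)
        (fun x i j => G' (t, x) i j) Cw (fun i j => (hG'm i j).comp measurable_prodMk_left)
        (fun x i j => hG'b t ht x i j) γ hγ0 hγB
      simpa only [hHr, hS] using key
    -- the relative entropy at time `t`, and the energy domination of the static functional
    have hK₀ : InformationTheory.klDiv ((Φ N).lawAt P t) (localGibbsMeasure σ (a t) (u t) (θ t) N) ≤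
        ENNReal.ofReal (((N : ℝ) + 1) * |h N|) :=
      (hKL N t htc).trans (ENNReal.ofReal_le_ofReal (mul_le_mul_of_nonneg_left (le_abs_self _) (by positivity)))
    have hFA : ∀ c, |Hr (t, c)| ≤ 19 * Cw * ((((N + 1 : ℕ)) : ℝ)⁻¹ * ∑ a, ‖(c a).2‖ ^ 2) := fun c => by
      rw [hHr]
      simp only [hS, hG'eq t ht]
      exact FluxClosureK.abs_integral_kinIntegrand_le c (hℓ N).1 (hℓ N).2 fun i j y => hCw t htc i j y
    have h := lintegral_abs_comp_flow_le_of_klDiv_le (Φ N) P (localGibbsMeasure σ (a t) (u t) (θ t) N) hPac t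
      (by positivity) hK₀ (hHrm.comp measurable_prodMk_left : Measurable fun c => Hr (t, c)) hFA
      (hE.trans_lt ENNReal.ofReal_lt_top).ne (mul_pos hγ0 (Nat.cast_add_one_pos N)) hexp
    refine h.trans (le_of_eq ?_)
    have hN1 : (N : ℝ) + 1 ≠ 0 := (Nat.cast_add_one_pos N).ne'
    congr 1
    rw [hbR]
    field_simp
    ring
  -- (D) integrate the `t`-independent bound over `(0, τ]`
  have hD : ∫⁻ t in Ioc 0 τ, (∫⁻ z, ENNReal.ofReal |Hr (t, (Φ N).flow t z)| ∂P) ≤ ENNReal.ofReal τ * ENNReal.ofReal bR :=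
    calc ∫⁻ t in Ioc 0 τ, (∫⁻ z, ENNReal.ofReal |Hr (t, (Φ N).flow t z)| ∂P) ≤ ∫⁻ _t in Ioc 0 τ, ENNReal.ofReal bR :=
          lintegral_mono_ae ((ae_restrict_iff' measurableSet_Ioc).2 (ae_of_all _ fun t ht => hC t ht))
      _ = ENNReal.ofReal τ * ENNReal.ofReal bR := by rw [setLIntegral_const, Real.volume_Ioc, sub_zero, mul_comm]
  -- assemble
  have hgoal : ∫⁻ z, ENNReal.ofReal |∫ t in Ioc 0 τ, ∫ x, ∑ i, ∑ j, S ((Φ N).flow t z, x) i j *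
      Torus.partialDeriv j (fun y => w t y i) x| ∂P ≤ ηe :=
    calc ∫⁻ z, ENNReal.ofReal |∫ t in Ioc 0 τ, ∫ x, ∑ i, ∑ j, S ((Φ N).flow t z, x) i j *
          Torus.partialDeriv j (fun y => w t y i) x| ∂P
        ≤ ∫⁻ z, (∫⁻ t in Ioc 0 τ, ENNReal.ofReal |Hr (t, (Φ N).flow t z)|) ∂P := lintegral_mono fun z => hA z
      _ = ∫⁻ t in Ioc 0 τ, (∫⁻ z, ENNReal.ofReal |Hr (t, (Φ N).flow t z)| ∂P) := hB
      _ ≤ ENNReal.ofReal τ * ENNReal.ofReal bR := hD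
      _ = ENNReal.ofReal (τ * bR) := (ENNReal.ofReal_mul hτ0).symm
      _ ≤ ENNReal.ofReal η' := ENNReal.ofReal_le_ofReal hβN.le
      _ ≤ ηe := hle
  simpa only [hS] using hgoal

end FluxClosureEnt
end Summit.AtomisticToContinuum.HydrodynamicLimit.Theorems

end
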